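import Literature.Geometry.Manifold.DeRhamBootstrap
import Literature.Geometry.Kaehler.ManifoldFormsPullback
import Literature.AlgebraicTopology.SingularHomology.SubsetCochainsPullback
import Literature.AlgebraicTopology.SingularHomology.CupRightMayerVietoris
import HarnessLib

/-!
# The de Rham comparison of an open subset, valued in the cohomology of its singular chains

For an open subset `W` of a `C^∞` manifold `M` (Hausdorff, second countable, finite-dimensional
boundaryless model) the de Rham homomorphism `Ψ_W : Ω•(W) ⟶ Hom(Δ^{sm}(W), ℝ)` (`deRhamMap`)
and the restriction `Hom(Δ(W), ℝ) ⟶ Hom(Δ^{sm}(W), ℝ)` (`smoothSubsetCochains.toSmooth`) are both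
isomorphisms on cohomology (`good_of_isOpen`, Bredon (1993), Thm. V.9.5). This file packages the
composite

`localDeRhamToSubset I hW k : Hᵏ(Ω•(W)) ⟶ Hᵏ(Hom(Δ(W), ℝ)) = H^k_M(W)`,

"`Ψ_W` followed by the inverse of restriction to smooth chains", valued in the tree's cohomology
of `W` computed in `C(M)` (`subsetCochains`), where restriction, pull-back, cup products with
global cocycles and the Mayer–Vietoris connecting map are available, and proves that it is an
isomorphism commuting with restriction (`localDeRhamToSubset_res`) and with the Mayer–Vietoris
connecting maps of the de Rham complexes and of `subsetCochains` (`localDeRhamToSubset_δ`: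
Bredon (1993), proof of Thm. V.9.5, the commutative ladders `deRhamMap_mv` and `mvToSmooth`).

## References

* G. E. Bredon, *Topology and Geometry*, GTM 139 (1993), §V.9, Thm. V.9.5.
* A. Hatcher, *Algebraic Topology* (2002), §3.1 p. 204 (Mayer–Vietoris in cohomology).
-/

noncomputable section

-- see "Implementation notes" in `…SingularHomology.SingularChainsConcrete`
set_option backward.isDefEq.respectTransparency false

open scoped Manifold ContDiff Topology
open CategoryTheory Limits Set Literature.AlgebraicTopology.SingularHomology Literature.Geometry.Kaehler

universe u

namespace Literature.Geometry.Manifold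

variable {E : Type u} [NormedAddCommGroup E] [NormedSpace ℝ E]
  {H : Type u} [TopologicalSpace H] (I : ModelWithCorners ℝ E H)
  {M : Type u} [TopologicalSpace M] [ChartedSpace H M] [IsManifold I ∞ M]
  [I.Boundaryless] [FiniteDimensional ℝ E] [T2Space M] [SecondCountableTopology M] [LocallyCompactSpace M]

/-! ### The comparison `Hᵏ(Ω•(W)) ⟶ H^k_M(W)` -/

/-- Restriction to smooth chains is an isomorphism on the cohomology of every open set
(`good_of_isOpen`). [cite: Bredon1993, Thm. V.9.5] -/
instance isIso_homologyMap_toSmooth {W : Set M} [Fact (IsOpen W)] (k : ℕ) :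
    IsIso (HomologicalComplex.homologyMap (smoothSubsetCochains.toSmooth I ℝ realCoeff.{u} W) k) :=
  (good_of_isOpen (I := I) (Fact.out : IsOpen W)).isIso_toSmooth k

/-- The de Rham homomorphism is an isomorphism on the cohomology of every open set
(`good_of_isOpen`). [cite: Bredon1993, Thm. V.9.5] -/
theorem isIso_homologyMap_deRhamMap {W : Set M} (hW : IsOpen W) (k : ℕ) :
    IsIso (HomologicalComplex.homologyMap (deRhamMap I hW) k) :=
  (good_of_isOpen (I := I) hW).isIso_deRhamMap hW k

/-- **The de Rham comparison of an open subset `W ⊆ M` valued in `H^k_M(W)`**: the de Rham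
homomorphism `Ψ_W` on cohomology followed by the inverse of (the cohomology isomorphism induced
by) restriction of cochains to smooth chains. [cite: Bredon1993, Thm. V.9.5] -/
def localDeRhamToSubset {W : Set M} (hW : IsOpen W) (k : ℕ) :
    (localDeRhamComplex I ℝ hW).homology k ⟶ (subsetCochains ℝ realCoeff.{u} W).homology k :=
  haveI : Fact (IsOpen W) := ⟨hW⟩
  HomologicalComplex.homologyMap (deRhamMap I hW) k ≫
    inv (HomologicalComplex.homologyMap (smoothSubsetCochains.toSmooth I ℝ realCoeff.{u} W) k)

variable {I}

/-- The defining relation: `localDeRhamToSubset ≫ H(toSmooth) = H(Ψ_W)`. [folklore] -/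
@[reassoc (attr := simp)]
theorem localDeRhamToSubset_comp_toSmooth {W : Set M} (hW : IsOpen W) (k : ℕ) :
    localDeRhamToSubset I hW k ≫
        HomologicalComplex.homologyMap (smoothSubsetCochains.toSmooth I ℝ realCoeff.{u} W) k =
      HomologicalComplex.homologyMap (deRhamMap I hW) k := by
  haveI : Fact (IsOpen W) := ⟨hW⟩
  rw [localDeRhamToSubset, Category.assoc, IsIso.inv_hom_id, Category.comp_id]

/-- `localDeRhamToSubset` is an isomorphism (de Rham's theorem on `W`). [cite: Bredon1993, Thm. V.9.5] -/
instance isIso_localDeRhamToSubset {W : Set M} (hW : IsOpen W) (k : ℕ) :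
    IsIso (localDeRhamToSubset I hW k) := by
  haveI : Fact (IsOpen W) := ⟨hW⟩
  haveI := isIso_homologyMap_deRhamMap (I := I) hW k
  rw [localDeRhamToSubset]
  infer_instance

/-- `localDeRhamToSubset` is bijective. [cite: Bredon1993, Thm. V.9.5] -/
theorem localDeRhamToSubset_bijective {W : Set M} (hW : IsOpen W) (k : ℕ) :
    Function.Bijective (localDeRhamToSubset I hW k) :=
  (ConcreteCategory.isIso_iff_bijective _).1 inferInstance

/-- To check an identity in `H^k_M(W)` it suffices to check it after restriction to smooth
chains. [folklore] -/
theorem homologyMap_toSmooth_injective {W : Set M} (hW : IsOpen W) (k : ℕ) :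
    Function.Injective
      (HomologicalComplex.homologyMap (smoothSubsetCochains.toSmooth I ℝ realCoeff.{u} W) k) := by
  haveI : Fact (IsOpen W) := ⟨hW⟩
  exact ((ConcreteCategory.isIso_iff_bijective _).1 inferInstance).1

/-! ### Restriction -/

/-- **`localDeRhamToSubset` commutes with restriction** to a smaller open set. [cite: Bredon1993, §V.9] -/
@[reassoc]
theorem localDeRhamToSubset_res {U W : Set M} (hU : IsOpen U) (hW : IsOpen W) (hUW : U ⊆ W) (k : ℕ) :
    HomologicalComplex.homologyMap (localDeRhamComplex.res I ℝ hU hW hUW) k ≫ localDeRhamToSubset I hU k =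
      localDeRhamToSubset I hW k ≫ subsetCochains.resH hUW k := by
  haveI : Fact (IsOpen U) := ⟨hU⟩
  apply (cancel_mono (HomologicalComplex.homologyMap (smoothSubsetCochains.toSmooth I ℝ realCoeff.{u} U) k)).1
  simp only [Category.assoc, localDeRhamToSubset_comp_toSmooth]
  rw [← HomologicalComplex.homologyMap_comp, deRhamMap_naturality_res hU hW hUW]
  change _ = _ ≫ HomologicalComplex.homologyMap (subsetCochains.res ℝ realCoeff.{u} hUW) k ≫ _
  conv_rhs => rw [← HomologicalComplex.homologyMap_comp, smoothSubsetCochains.res_comp_toSmooth,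
    HomologicalComplex.homologyMap_comp, localDeRhamToSubset_comp_toSmooth_assoc]
  rw [HomologicalComplex.homologyMap_comp]

/-- The same, applied to a class. [cite: Bredon1993, §V.9] -/
theorem localDeRhamToSubset_res_apply {U W : Set M} (hU : IsOpen U) (hW : IsOpen W) (hUW : U ⊆ W) (k : ℕ)
    (y : (localDeRhamComplex I ℝ hW).homology k) :
    localDeRhamToSubset I hU k (HomologicalComplex.homologyMap (localDeRhamComplex.res I ℝ hU hW hUW) k y) =
      subsetCochains.resH hUW k (localDeRhamToSubset I hW k y) := by
  rw [← ModuleCat.comp_apply, localDeRhamToSubset_res, ModuleCat.comp_apply]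

/-! ### Mayer–Vietoris -/

/-- **`localDeRhamToSubset` commutes with the Mayer–Vietoris connecting maps**: for open `A`, `B`,
`δ_Ω ≫ localDeRhamToSubset (A ∪ B) = localDeRhamToSubset (A ∩ B) ≫ mvδ`, where `δ_Ω` is the
connecting map of the short exact sequence of de Rham complexes
`Ω•(A ∪ B) → Ω•(A) ⊞ Ω•(B) → Ω•(A ∩ B)` and `mvδ` that of `subsetCochains` (Bredon (1993), proof of
Thm. V.9.5: the two commutative ladders `deRhamMap_mv`, `mvToSmooth`). [cite: Bredon1993, Thm. V.9.5] -/
@[reassoc]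
theorem localDeRhamToSubset_δ {A B : Set M} (hA : IsOpen A) (hB : IsOpen B) (k : ℕ) :
    (localDeRhamComplex.mvShortComplex_shortExact (I := I) (F := ℝ) (hA := hA) (hB := hB)).δ k (k + 1)
        (crel k) ≫ localDeRhamToSubset I (hA.union hB) (k + 1) =
      localDeRhamToSubset I (hA.inter hB) k ≫ subsetCochains.mvδ ℝ realCoeff.{u} hA hB k := by
  -- test against the injective composite `H(toSmooth (A ∪ B)) ≫ H(resSup)`
  haveI : Fact (IsOpen (A ∪ B)) := ⟨hA.union hB⟩
  haveI := smoothSubsetCochains.isIso_homologyMap_resSup (I := I) (N := realCoeff.{u}) hA hB (k + 1)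
  apply (cancel_mono (HomologicalComplex.homologyMap (smoothSubsetCochains.toSmooth I ℝ realCoeff.{u} (A ∪ B)) (k + 1))).1
  apply (cancel_mono (HomologicalComplex.homologyMap (smoothSubsetCochains.resSup I ℝ realCoeff.{u} A B) (k + 1))).1
  -- left-hand side: the ladder `deRhamMap_mv`
  have hl := HomologicalComplex.HomologySequence.δ_naturality (deRhamMap_mv I hA hB)
    localDeRhamComplex.mvShortComplex_shortExact
    (smoothSubsetCochains.mvShortComplex_shortExact I ℝ realCoeff.{u} A B) k (k + 1) (crel k)
  have hτ₁ : (deRhamMap_mv I hA hB).τ₁ = deRhamMap I (hA.union hB) ≫ smoothSubsetCochains.resSup I ℝ realCoeff A B := rfl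
  have hτ₃ : (deRhamMap_mv I hA hB).τ₃ = deRhamMap I (hA.inter hB) := rfl
  rw [hτ₁, hτ₃, HomologicalComplex.homologyMap_comp] at hl
  rw [Category.assoc, Category.assoc, localDeRhamToSubset_comp_toSmooth_assoc, hl]
  -- right-hand side: the ladder `mvToSmooth`
  have hr := HomologicalComplex.HomologySequence.δ_naturality (smoothSubsetCochains.mvToSmooth I ℝ realCoeff.{u} A B)
    (subsetCochains.mvShortComplex_shortExact ℝ realCoeff.{u} A B)
    (smoothSubsetCochains.mvShortComplex_shortExact I ℝ realCoeff.{u} A B) k (k + 1) (crel k)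
  rw [smoothSubsetCochains.mvToSmooth_τ₁, smoothSubsetCochains.mvToSmooth_τ₃] at hr
  simp only [Category.assoc]
  rw [show HomologicalComplex.homologyMap (smoothSubsetCochains.toSmooth I ℝ realCoeff.{u} (A ∪ B)) (k + 1) ≫
      HomologicalComplex.homologyMap (smoothSubsetCochains.resSup I ℝ realCoeff.{u} A B) (k + 1) =
      HomologicalComplex.homologyMap (subsetCochains.resSup ℝ realCoeff.{u} A B) (k + 1) ≫
        HomologicalComplex.homologyMap (smoothSubsetCochains.toSmoothSup I ℝ realCoeff.{u} A B) (k + 1) from by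
    rw [← HomologicalComplex.homologyMap_comp, ← HomologicalComplex.homologyMap_comp,
      smoothSubsetCochains.resSup_comp_toSmoothSup]]
  have hδ : subsetCochains.mvδ ℝ realCoeff.{u} hA hB k ≫
      HomologicalComplex.homologyMap (subsetCochains.resSup ℝ realCoeff.{u} A B) (k + 1) =
      (subsetCochains.mvShortComplex_shortExact ℝ realCoeff.{u} A B).δ k (k + 1) (crel k) := by
    ext y
    exact subsetCochains.homologyMap_resSup_mvδ_eq hA hB k y
  rw [reassoc_of% hδ, hr, localDeRhamToSubset_comp_toSmooth_assoc]

/-- The same, applied to a class. [cite: Bredon1993, Thm. V.9.5] -/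
theorem localDeRhamToSubset_δ_apply {A B : Set M} (hA : IsOpen A) (hB : IsOpen B) (k : ℕ)
    (y : (localDeRhamComplex I ℝ (hA.inter hB)).homology k) :
    localDeRhamToSubset I (hA.union hB) (k + 1)
        ((localDeRhamComplex.mvShortComplex_shortExact (I := I) (F := ℝ) (hA := hA) (hB := hB)).δ k (k + 1)
          (crel k) y) =
      subsetCochains.mvδ ℝ realCoeff.{u} hA hB k (localDeRhamToSubset I (hA.inter hB) k y) := by
  rw [← ModuleCat.comp_apply, localDeRhamToSubset_δ, ModuleCat.comp_apply]

/-! ### Pull-back along a `C^∞` map into an open set -/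

section Pullback

variable {E' : Type u} [NormedAddCommGroup E'] [NormedSpace ℝ E'] {H' : Type u} [TopologicalSpace H']
  {I' : ModelWithCorners ℝ E' H'} {N : Type u} [TopologicalSpace N] [ChartedSpace H' N] [IsManifold I' ∞ N]

omit [I.Boundaryless] [FiniteDimensional ℝ E] [T2Space M] [SecondCountableTopology M] [LocallyCompactSpace M] in
/-- The pull-back along a `C^∞` map `f : M → N` with image in an open set `W ⊆ N` of a form on
`W` is a smooth form on all of `M` (Warner (1983), 2.22, pointwise: near `x` the map lands in
`W`, where the form is smooth). [cite: WarnerGTM94, 2.22] -/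
theorem pullback_mem_smoothFormsOn_univ_of_forall_mem {f : M → N} (hf : ContMDiff I I' ∞ f) {W : Set N}
    (hfW : ∀ x, f x ∈ W) {k : ℕ} {η : MForm I' N ℝ k} (hη : η ∈ smoothFormsOn I' ℝ W k) :
    η.pullback I f ∈ smoothFormsOn I ℝ (univ : Set M) k := by
  refine ⟨fun x _ ↦ ?_, fun x hx ↦ (hx (mem_univ x)).elim⟩
  exact MForm.SmoothAt.pullback (Filter.Eventually.of_forall fun z ↦ hf.contMDiffAt) (hη.1 _ (hfW x))

omit [I.Boundaryless] [FiniteDimensional ℝ E] [T2Space M] [SecondCountableTopology M] [LocallyCompactSpace M] in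
/-- `d` commutes with this pull-back: `d_M (f^* η) = f^* (d_W η)`. [cite: WarnerGTM94, Prop. 2.23] -/
theorem mextDeriv_pullback_of_forall_mem {f : M → N} (hf : ContMDiff I I' ∞ f) {W : Set N}
    (hfW : ∀ x, f x ∈ W) {k : ℕ} {η : MForm I' N ℝ k} (hη : η ∈ smoothFormsOn I' ℝ W k) :
    mextDeriv (η.pullback I f) = ((mextDeriv η).restr W).pullback I f := by
  funext x
  rw [mextDeriv_pullback_apply (Filter.Eventually.of_forall fun z ↦ hf.contMDiffAt) (hη.1 _ (hfW x))]
  ext v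
  rw [MForm.pullback_apply, MForm.pullback_apply, MForm.restr_apply_of_mem _ (hfW x)]

variable (I) in
/-- **Pull-back of the de Rham complex of an open set `W ⊆ N` along a `C^∞` map `f : M → N` with
image in `W`**, as a morphism of cochain complexes `Ω•(W) ⟶ Ω•(M)` (Warner (1983), 2.22–2.23).
[cite: WarnerGTM94, Prop. 2.23] -/
def localDeRhamComplex.pullbackInto {f : M → N} (hf : ContMDiff I I' ∞ f) {W : Set N} (hW : IsOpen W)
    (hfW : ∀ x, f x ∈ W) :
    localDeRhamComplex I' ℝ hW ⟶ localDeRhamComplex I ℝ (isOpen_univ : IsOpen (univ : Set M)) where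
  f k := ModuleCat.ofHom
    { toFun := fun η ↦ ⟨(η.1 : MForm I' N ℝ k).pullback I f, pullback_mem_smoothFormsOn_univ_of_forall_mem hf hfW η.2⟩
      map_add' := fun _ _ ↦ rfl
      map_smul' := fun _ _ ↦ rfl }
  comm' i j hij := by
    change i + 1 = j at hij
    subst hij
    rw [localDeRhamComplex_d, localDeRhamComplex_d]
    refine ModuleCat.hom_ext (LinearMap.ext fun η ↦ Subtype.ext ?_)
    change (mextDeriv ((η.1 : MForm I' N ℝ i).pullback I f)).restr univ =
      ((mextDeriv (η.1 : MForm I' N ℝ i)).restr W).pullback I f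
    rw [MForm.restr_univ]
    exact mextDeriv_pullback_of_forall_mem hf hfW η.2

omit [I.Boundaryless] [FiniteDimensional ℝ E] [T2Space M] [SecondCountableTopology M] [LocallyCompactSpace M] in
/-- The pull-back morphism on an element. [folklore] -/
@[simp]
theorem localDeRhamComplex.pullbackInto_f_apply_coe {f : M → N} (hf : ContMDiff I I' ∞ f) {W : Set N}
    (hW : IsOpen W) (hfW : ∀ x, f x ∈ W) (k : ℕ) (η : (localDeRhamComplex I' ℝ hW).X k) :
    ((localDeRhamComplex.pullbackInto I hf hW hfW).f k η).1 = (η.1 : MForm I' N ℝ k).pullback I f :=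
  rfl

/-- Maps with image in `W` map `univ` into `W`. [folklore] -/
theorem mapsTo_univ_of_forall_mem {α β : Type*} {f : α → β} {W : Set β} (hfW : ∀ x, f x ∈ W) : MapsTo f univ W :=
  fun x _ ↦ hfW x

/-- **Push-forward of smooth chains of `M` to smooth chains of `N` in `W`** along a `C^∞` map with
image in `W`. [cite: LeeSmoothManifolds2013, Ch. 18 p. 474] -/
abbrev smoothPushInto {f : M → N} (hf : ContMDiff I I' ∞ f) {W : Set N} (hfW : ∀ x, f x ∈ W) :
    (smoothChainsInSub I ℝ ℝ M univ).toComplex ⟶ (smoothChainsInSub I' ℝ ℝ N W).toComplex :=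
  Subcomplex.subMap (csingularChainComplex.map ℝ ℝ ⟨f, hf.continuous⟩) _ _
    (smoothChainsInSub_le_comap_map hf (mapsTo_univ_of_forall_mem hfW))

omit [I.Boundaryless] [FiniteDimensional ℝ E] [T2Space M] [SecondCountableTopology M] [LocallyCompactSpace M] in
/-- **Naturality of the de Rham homomorphism under `C^∞` maps into an open set**:
`f^* ≫ Ψ_M = Ψ_W ≫ (f♯)^*`, i.e. `∫_c f^*η = ∫_{f♯ c} η` (Lee (2013), Prop. 18.9 (c); Bredon (1993),
§V.9). [cite: LeeSmoothManifolds2013, Thm. 18.14] -/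
theorem pullbackInto_comp_deRhamMap {f : M → N} (hf : ContMDiff I I' ∞ f) {W : Set N} (hW : IsOpen W)
    (hfW : ∀ x, f x ∈ W) :
    localDeRhamComplex.pullbackInto I hf hW hfW ≫ deRhamMap I (isOpen_univ : IsOpen (univ : Set M)) =
      deRhamMap I' hW ≫ dualMap ℝ realCoeff (smoothPushInto hf hfW) := by
  ext k η
  change (deRhamMap I _).f k ((localDeRhamComplex.pullbackInto I hf hW hfW).f k η) =
    (dualMap ℝ realCoeff (smoothPushInto hf hfW)).f k ((deRhamMap I' _).f k η)
  rw [dualMap_f_apply]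
  refine ModuleCat.hom_ext (LinearMap.ext fun c ↦ ULift.ext _ _ ?_)
  change integrationFunctional ((η.1 : MForm I' N ℝ k).pullback I f) c.1 =
    integrationFunctional (η.1 : MForm I' N ℝ k) ((smoothPushInto hf hfW).f k c).1
  rw [Subcomplex.subMap_f_apply_val, csingularChainComplex.map_f_apply,
    integrationFunctional_mapDomain hf _ c.2.1]

omit [IsManifold I ∞ M] [I.Boundaryless] [FiniteDimensional ℝ E] [T2Space M] [SecondCountableTopology M]
  [LocallyCompactSpace M] [IsManifold I' ∞ N] in
/-- **Naturality of restriction to smooth chains under `C^∞` maps into an open set**: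
`toSmooth_W ≫ (f♯^{sm})^* = (f♯)^* ≫ toSmooth_M`. [folklore] -/
theorem toSmooth_comp_dualMap_smoothPushInto [IsManifold I ∞ M] [IsManifold I' ∞ N] {f : M → N}
    (hf : ContMDiff I I' ∞ f) {W : Set N} (hfW : ∀ x, f x ∈ W) :
    smoothSubsetCochains.toSmooth I' ℝ realCoeff.{u} W ≫ dualMap ℝ realCoeff (smoothPushInto hf hfW) =
      subsetCochains.pull ℝ realCoeff.{u} ⟨f, hf.continuous⟩ (mapsTo_univ_of_forall_mem hfW) ≫
        smoothSubsetCochains.toSmooth I ℝ realCoeff.{u} (univ : Set M) := by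
  rw [smoothSubsetCochains.toSmooth, smoothSubsetCochains.toSmooth, subsetCochains.pull, ← dualMap_comp,
    ← dualMap_comp]
  congr 1

/-- **`localDeRhamToSubset` is natural for `C^∞` maps into an open set**:
`H(f^*) ≫ localDeRhamToSubset_M = localDeRhamToSubset_W ≫ f^*` with the pull-back `pullH` of the
cohomology of subsets. [cite: Bredon1993, Thm. V.9.5] -/
@[reassoc]
theorem localDeRhamToSubset_pullbackInto [I'.Boundaryless] [FiniteDimensional ℝ E'] [T2Space N]
    [SecondCountableTopology N] [LocallyCompactSpace N] {f : M → N} (hf : ContMDiff I I' ∞ f) {W : Set N}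
    (hW : IsOpen W) (hfW : ∀ x, f x ∈ W) (k : ℕ) :
    HomologicalComplex.homologyMap (localDeRhamComplex.pullbackInto I hf hW hfW) k ≫
        localDeRhamToSubset I (isOpen_univ : IsOpen (univ : Set M)) k =
      localDeRhamToSubset I' hW k ≫
        subsetCochains.pullH (N := realCoeff.{u}) ⟨f, hf.continuous⟩ (mapsTo_univ_of_forall_mem hfW) k := by
  haveI : Fact (IsOpen (univ : Set M)) := ⟨isOpen_univ⟩
  apply (cancel_mono (HomologicalComplex.homologyMap
    (smoothSubsetCochains.toSmooth I ℝ realCoeff.{u} (univ : Set M)) k)).1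
  simp only [Category.assoc, localDeRhamToSubset_comp_toSmooth]
  rw [← HomologicalComplex.homologyMap_comp, pullbackInto_comp_deRhamMap hf hW hfW]
  change _ = _ ≫ HomologicalComplex.homologyMap (subsetCochains.pull ℝ realCoeff.{u} ⟨f, hf.continuous⟩
    (mapsTo_univ_of_forall_mem hfW)) k ≫ _
  conv_rhs => rw [← HomologicalComplex.homologyMap_comp, ← toSmooth_comp_dualMap_smoothPushInto hf hfW,
    HomologicalComplex.homologyMap_comp, localDeRhamToSubset_comp_toSmooth_assoc]
  rw [HomologicalComplex.homologyMap_comp]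

/-- The same, applied to a class. [cite: Bredon1993, Thm. V.9.5] -/
theorem localDeRhamToSubset_pullbackInto_apply [I'.Boundaryless] [FiniteDimensional ℝ E'] [T2Space N]
    [SecondCountableTopology N] [LocallyCompactSpace N] {f : M → N} (hf : ContMDiff I I' ∞ f) {W : Set N}
    (hW : IsOpen W) (hfW : ∀ x, f x ∈ W) (k : ℕ) (y : (localDeRhamComplex I' ℝ hW).homology k) :
    localDeRhamToSubset I (isOpen_univ : IsOpen (univ : Set M)) k
        (HomologicalComplex.homologyMap (localDeRhamComplex.pullbackInto I hf hW hfW) k y) =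
      subsetCochains.pullH (N := realCoeff.{u}) ⟨f, hf.continuous⟩ (mapsTo_univ_of_forall_mem hfW) k
        (localDeRhamToSubset I' hW k y) := by
  rw [← ModuleCat.comp_apply, localDeRhamToSubset_pullbackInto, ModuleCat.comp_apply]

end Pullback

end Literature.Geometry.Manifold
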